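import Mathlib
import HarnessLib
import Summits.ResolutionOfSingularities.ResolutionOfSingularities.Theorems.WildQuotientsWildQuotientResolutionS1aChartRingTameNode
import Summits.ResolutionOfSingularities.ResolutionOfSingularities.Theorems.WildQuotientsWildQuotientResolutionS1aNodeReindex

/-!
# S1a — NODE DATA of a blow-up chart: `Γ(D₊(b t)) ≃ 𝒜ʼ 0` for a `Π ZMod`-graded tame node on the chart ring

[OURS · L1 W4.5c · lead-1 g6] — NOT a statement of the manuscript; counted 0; AI-level work, weaker than expert
review. Crux stmt-ResolutionOfSingularities-17941 (`WildQuotients.CyclicQuotientFourfolds`), line `s1a-logminvertex`,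
stub `stub_localGame` (producer); A5b design `Cruxes/CyclicQuotientFourfolds/Lines/s1a-logminvertex-A5B-DESIGN.md` (N3)
«degree-0 bridge + NodeReindex», plan-1 RULING 22:26:15Z (A5b plan of record).

H4b `IsNodeChart p ρ g₀ O` asks, for the coordinate ring of the chart, a tame node `(B', 𝒜', σ')` graded by
`Π j : Fin m', ZMod (r' j)` and a ring iso `Γ(V, O) ≃+* ↥(𝒜' 0)`. For a blow-up chart `D₊(b t)` of `Bl_{K d}(Spec 𝒜₀)`
the coordinate ring is the treeʼs `HomogeneousLocalization.Away (reesGrading (K d)) (reesT b hb)` (`AffineBlowup.lean`).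
This file produces the ring-level node data from the landed pieces:

* `subringEquivChartGradingZero` — `coarseChart ≃+* 𝒜ʼ(0,0)` from `chartGrading_zero_eq_coarseChart` (Veronese);
* **`exists_chartNodeData`** — for a `Π j : Fin m, ZMod (r j)`-graded tame node `(B, 𝒜, σ)` and a σ-invariant
  normalised cover element `b ∈ K d` (`d` Veronese): `∃ 𝒜' (GradedRing 𝒜') (e' : (Rees(K d))_{(bt)} ≃+* 𝒜' 0)` on
  `B' = ChartRing 𝒜 f w d b hb`, graded by `Π j : Fin (m+1), ZMod (Fin.cons 0 r j)` (`NodeReindex.reindex` of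
  `chartGrading` along `consIndexEquiv r`), with `IsTameNode p B' 𝒜' (sigmaChart …)` (`chartRing_isTameNode` +
  `isTameNode_reindex`) and the PIN `(e' t : B') = coarseChartMap t` (so `e'` IS the chart map of (G1b); (S3) of the
  design computes the intertwining with `sigmaChart` through `coarseChartMap_mk` / `sigmaChart_algebraMap_mul_invSelf_pow`).
-/

set_option linter.dupNamespace false

noncomputable section

open Literature.AlgebraicGeometry.Resolution
open scoped LaurentPolynomial
open Summit.ResolutionOfSingularities.ResolutionOfSingularities.Theorems.WildQuotientResolution.S1.ProducerStep

namespace Summit.ResolutionOfSingularities.ResolutionOfSingularities.Theorems.WildQuotientResolution.S1.CoarseChart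

universe u v

section GradeZero

variable {ι : Type v} [AddCommGroup ι] [DecidableEq ι] {B : Type u} [CommRing B]
  (𝒜 : ι → AddSubgroup B) [GradedRing 𝒜] {c : ℕ} (f : Fin c → B) {δ : Fin c → ι} (w : Fin c → ℕ)
  (hf : ∀ i, f i ∈ 𝒜 (δ i)) (d : ℕ) (b : ↥(𝒜 0)) (hb : b ∈ (traceFiltration 𝒜 f w).ideal d)

/-- `coarseChart ≃+* 𝒜ʼ 0` for the Rees bigrading of the chart ring (both carry the ambient ring structure), given a
Veronese degree. -/
def subringEquivChartGradingZero (hd : VeroneseNormalised 𝒜 f w d) :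
    letI := chartGradedRing 𝒜 f w hf d b hb
    ↥(coarseChart 𝒜 f w d b hb) ≃+* ↥(chartGrading 𝒜 f w hf d b hb 0) :=
  letI := chartGradedRing 𝒜 f w hf d b hb
  { toFun := fun x => ⟨x.1, by
      have h := chartGrading_zero_eq_coarseChart 𝒜 f w hf d b hb hd
      change x.1 ∈ chartGrading 𝒜 f w hf d b hb (0, 0)
      rw [h]; exact x.2⟩
    invFun := fun x => ⟨x.1, by
      have h := chartGrading_zero_eq_coarseChart 𝒜 f w hf d b hb hd
      have hx : x.1 ∈ chartGrading 𝒜 f w hf d b hb (0, 0) := x.2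
      rw [h] at hx; exact hx⟩
    left_inv := fun _ => rfl
    right_inv := fun _ => rfl
    map_mul' := fun _ _ => rfl
    map_add' := fun _ _ => rfl }

/-- The equivalence is the identity on underlying elements. -/
@[simp] theorem coe_subringEquivChartGradingZero (hd : VeroneseNormalised 𝒜 f w d) (x : ↥(coarseChart 𝒜 f w d b hb)) :
    letI := chartGradedRing 𝒜 f w hf d b hb
    ((subringEquivChartGradingZero 𝒜 f w hf d b hb hd x : ↥(chartGrading 𝒜 f w hf d b hb 0)) :
      ChartRing 𝒜 f w d b hb) = x :=
  rfl

end GradeZero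

section NodeData

variable {m : ℕ} (r : Fin m → ℕ) {B : Type u} [CommRing B]
  (𝒜 : (Π j : Fin m, ZMod (r j)) → AddSubgroup B) [GradedRing 𝒜] {c : ℕ} (f : Fin c → B)
  {δ : Fin c → Π j : Fin m, ZMod (r j)} (w : Fin c → ℕ)
  (hf : ∀ i, f i ∈ 𝒜 (δ i)) (d : ℕ) (b : ↥(𝒜 0)) (hb : b ∈ (traceFiltration 𝒜 f w).ideal d)
  (σ : B ≃+* B)
  (hσJ : ∀ n : ℕ, ((weightedFiltration f w).ideal n).map (σ : B →+* B) ≤ (weightedFiltration f w).ideal n)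
  {p : ℕ} (hp : 0 < p) (hσp : ∀ x : B, (⇑σ)^[p] x = x) (hσb : σ (b : B) = b)

include hf in
/-- **NODE DATA of the blow-up chart `D₊(b t)`.** [OURS · L1 W4.5c] -/
theorem exists_chartNodeData (hnode : IsTameNode p B 𝒜 σ) (hw : ∀ i, 0 < w i)
    (hK1 : RingTheory.Sequence.IsRegular B (List.ofFn f))
    (hK1' : IsRegularRing (B ⧸ Ideal.span (Set.range f))) (hver : VeroneseNormalised 𝒜 f w d) :
    ∃ (𝒜' : (Π j : Fin (m + 1), ZMod ((Fin.cons 0 r : Fin (m + 1) → ℕ) j)) → AddSubgroup (ChartRing 𝒜 f w d b hb))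
      (_ : GradedRing 𝒜')
      (e' : HomogeneousLocalization.Away (reesGrading ((traceFiltration 𝒜 f w).ideal d)) (reesT b hb) ≃+* ↥(𝒜' 0)),
      IsTameNode p (ChartRing 𝒜 f w d b hb) 𝒜' (sigmaChart 𝒜 f w d b hb σ hσJ hp hσp hσb) ∧
      ∀ t, ((e' t : ↥(𝒜' 0)) : ChartRing 𝒜 f w d b hb) = coarseChartMap 𝒜 f w d b hb t := by
  letI := chartGradedRing 𝒜 f w hf d b hb
  letI := reindexGradedRing (chartGrading 𝒜 f w hf d b hb) (consIndexEquiv r)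
  refine ⟨reindex (chartGrading 𝒜 f w hf d b hb) (consIndexEquiv r), inferInstance,
    ((coarseChartEquiv 𝒜 f w d b hb).trans (subringEquivChartGradingZero 𝒜 f w hf d b hb hver)).trans
      (gradeZeroEquivOfEq (chartGrading 𝒜 f w hf d b hb) (reindex (chartGrading 𝒜 f w hf d b hb) (consIndexEquiv r))
        (reindex_zero _ _)),
    isTameNode_reindex (chartGrading 𝒜 f w hf d b hb) (consIndexEquiv r) p _
      (chartRing_isTameNode 𝒜 f w hf d b hb σ hσJ hp hσp hσb hnode hw hK1 hK1' hver.1),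
    fun t => rfl⟩

end NodeData

end Summit.ResolutionOfSingularities.ResolutionOfSingularities.Theorems.WildQuotientResolution.S1.CoarseChart

end
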